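import Mathlib.Analysis.SpecialFunctions.Integrals.Basic
import Mathlib.Analysis.SpecialFunctions.Trigonometric.DerivHyp
import Mathlib.Analysis.Complex.ExponentialBounds
import Mathlib.MeasureTheory.Integral.IntegralEqImproper
import Mathlib.Analysis.Calculus.MeanValue
import Literature.Analysis.FluidPDE.GaussianVortexPlanar
import HarnessLib

/-!
# The radial mode equations of Maekawa's kernel lemma

Support file (everything proved, `[folklore]`) for the proof of Maekawa's kernel lemma
`ker Λ = X₀ ⊕ span{∂₁G, ∂₂G}` (`Literature.Analysis.FluidPDE.GallayMaekawa2016_lem27_classical`,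
Gallay–Maekawa 2016, Lemma 2.7). Writing `v^G = Ω ξ^⊥`, `Ω(r) = (8π)⁻¹φ(r²/4)`
(`φ = burgersPhi`) and `∇G = −(G/2)ξ`, a classical kernel element `w` of
`Λ w = v^G·∇w + (K∗w)·∇G` satisfies `∂_θ w = Φ(|ξ|) ξ·(K∗w)(ξ)` with the **kernel weight**
`Φ = G/(2Ω) = 4πG/φ`, i.e. `Φ(r) = e^{-r²/4}/φ(r²/4) = (r²/4)/(e^{r²/4} − 1)` (`kerWeight`), and
its angular Fourier modes `f = ŵ_n`, `n ≥ 1`, solve the radial integral equations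

  `f(r) = (Φ(r)/(2n)) ∫_0^∞ ρ (min(r,ρ)/max(r,ρ))^n f(ρ) dρ`,  `∫_0^∞ ρ |f(ρ)| dρ < ∞`.

This file solves these equations by one-variable calculus:

* `kerWeight`: `0 < Φ ≤ 1`, `Φ(r) ≤ 4/r²`, `Φ(r) ≤ e^{-r²/8}`, continuity;
* the **kernel bound** `∫_0^∞ ρ (min/max)² Φ(ρ) dρ ≤ 7/2 < 4` for every `r > 0`
  (`integral_mul_ratio_sq_mul_kerWeight_le`; cases `r ≤ 2`, `2 ≤ r ≤ 2√2`, `r ≥ 2√2`);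
* **modes `n ≥ 2` vanish** (`radialMode_eq_zero`): `|f| ≤ MΦ` improves to `|f| ≤ (7/8)MΦ`;
* **mode `n = 1` is one-dimensional** (`radialMode_one_eq_smul`): every solution is a multiple
  of `h(r) = r e^{-r²/4}` (the first mode of `x₁G`), by a Wronskian argument for
  `A_f = ∫_0^r ρ²f`, `B_f = ∫_r^∞ f` (`2rf = Φ(A_f + r²B_f)`, `(A_fB_h − A_hB_f)' = 0`,
  then `(B_f/B_h)' = 0`); `h` is checked to solve the equation by the explicit integrals
  `∫_0^r ρ³e^{-ρ²/4} dρ = 8 − 2(r²+4)e^{-r²/4}`, `∫_r^∞ ρ e^{-ρ²/4} dρ = 2e^{-r²/4}`.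

## References

* Th. Gallay, Y. Maekawa, *Existence and stability of viscous vortices*, arXiv:1610.08384, §2.2,
  Lemma 2.7 (= Y. Maekawa, J. Math. Fluid Mech. 13 (2011) 515–532). [GallayMaekawa2016]
* Th. Gallay, C. E. Wayne, *Existence and stability of asymmetric Burgers vortices*, J. Math.
  Fluid Mech. 9 (2007), proof of Prop. 3.1 (the weight `h(r) = (r²/4)/(e^{r²/4} − 1)` and
  `sup r²h < 4`). [GallayWayne2006]
-/

noncomputable section

open Set Function Filter MeasureTheory
open scoped Real Topology

namespace Literature.Analysis.FluidPDE

/-! ### The kernel weight `Φ = e^{-s}/φ(s)`, `s = r²/4` -/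

/-- The **kernel weight** `Φ(r) = e^{-r²/4}/φ(r²/4) = (r²/4)/(e^{r²/4} − 1)` (`= 1` at `r = 0`),
`Φ = G/(2Ω) = 4πG/φ(|ξ|²/4)` for the Gaussian vortex (`gaussVortexProfile`,
`gaussVortexVelocity`); Gallay–Wayne's `h(r)`. [cite: GallayWayne2006, proof of Prop. 3.1] -/
def kerWeight (r : ℝ) : ℝ :=
  Real.exp (-(r ^ 2 / 4)) / burgersPhi (r ^ 2 / 4)

/-- `Φ > 0`. [folklore] -/
theorem kerWeight_pos (r : ℝ) : 0 < kerWeight r :=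
  div_pos (Real.exp_pos _) (burgersPhi_pos _)

/-- `Φ(0) = 1`. [folklore] -/
@[simp] theorem kerWeight_zero : kerWeight 0 = 1 := by simp [kerWeight]

/-- `Φ` is even. [folklore] -/
theorem kerWeight_neg (r : ℝ) : kerWeight (-r) = kerWeight r := by simp [kerWeight]

/-- `Φ` depends on `|r|` only. [folklore] -/
theorem kerWeight_abs (r : ℝ) : kerWeight |r| = kerWeight r := by simp [kerWeight]

/-- The closed form `Φ(r) = s/(eˢ − 1)`, `s = r²/4`, for `r ≠ 0`. [folklore] -/
theorem kerWeight_eq {r : ℝ} (hr : r ≠ 0) :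
    kerWeight r = (r ^ 2 / 4) / (Real.exp (r ^ 2 / 4) - 1) := by
  have hs : r ^ 2 / 4 ≠ 0 := by positivity
  have hs' : 0 < r ^ 2 / 4 := by positivity
  have he : Real.exp (r ^ 2 / 4) - 1 ≠ 0 := by
    have : 1 < Real.exp (r ^ 2 / 4) := Real.one_lt_exp_iff.2 hs'
    linarith
  rw [kerWeight, burgersPhi_of_ne_zero hs, Real.exp_neg]
  have hE : Real.exp (r ^ 2 / 4) ≠ 0 := (Real.exp_pos _).ne'
  field_simp

/-- `Φ = 4πG/φ(|ξ|²/4)` on the plane: the kernel weight of the Gaussian vortex. [folklore] -/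
theorem kerWeight_norm_eq (ξ : EuclideanSpace ℝ (Fin 2)) :
    kerWeight ‖ξ‖ = 4 * π * gaussVortexProfile ξ / burgersPhi (‖ξ‖ ^ 2 / 4) := by
  rw [kerWeight, gaussVortexProfile]
  have : (4 * π : ℝ) ≠ 0 := by positivity
  field_simp

/-- `Φ ≤ 1` (`s ≤ eˢ − 1`). [folklore] -/
theorem kerWeight_le_one (r : ℝ) : kerWeight r ≤ 1 := by
  rcases eq_or_ne r 0 with h | h
  · simp [h]
  · rw [kerWeight_eq h]
    have hs : 0 < r ^ 2 / 4 := by positivity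
    have h1 : r ^ 2 / 4 + 1 ≤ Real.exp (r ^ 2 / 4) := Real.add_one_le_exp _
    rw [div_le_one (by linarith)]
    linarith

/-- `Φ(r) ≤ 4/r²` (`s² ≤ eˢ − 1`, from `e^{s/2} ≥ 1 + s/2 + s²/8`). [folklore] -/
theorem kerWeight_le_div_sq {r : ℝ} (hr : r ≠ 0) : kerWeight r ≤ 4 / r ^ 2 := by
  rw [kerWeight_eq hr]
  set s := r ^ 2 / 4 with hs_def
  have hs : 0 < s := by positivity
  have hq := Real.quadratic_le_exp_of_nonneg (half_pos hs).le
  have hexp : Real.exp s = Real.exp (s / 2) ^ 2 := by rw [← Real.exp_nat_mul]; ring_nf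
  have h0 : 0 ≤ 1 + s / 2 + (s / 2) ^ 2 / 2 := by positivity
  have hsq : (1 + s / 2 + (s / 2) ^ 2 / 2) ^ 2 ≤ Real.exp s := by
    rw [hexp]; exact pow_le_pow_left₀ h0 hq 2
  have hkey : s ^ 2 ≤ Real.exp s - 1 := by nlinarith [sq_nonneg (s - 2), sq_nonneg s]
  have hpos : 0 < Real.exp s - 1 := by linarith [sq_nonneg s, pow_pos hs 2]
  rw [div_le_div_iff₀ hpos (by positivity), show (4 : ℝ) = 4 by rfl]
  have : r ^ 2 = 4 * s := by rw [hs_def]; ring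
  rw [this]
  nlinarith

/-- `Φ(r) ≤ e^{-r²/8}` (`s ≤ 2 sinh(s/2)`). [folklore] -/
theorem kerWeight_le_exp (r : ℝ) : kerWeight r ≤ Real.exp (-(r ^ 2 / 8)) := by
  rcases eq_or_ne r 0 with h | h
  · simp [h]
  rw [kerWeight_eq h]
  set s := r ^ 2 / 4 with hs_def
  have hs : 0 < s := by positivity
  have hsinh : s / 2 ≤ Real.sinh (s / 2) := Real.self_le_sinh_iff.2 (half_pos hs).le
  rw [Real.sinh_eq] at hsinh
  have hpos : 0 < Real.exp s - 1 := by
    have : 1 < Real.exp s := Real.one_lt_exp_iff.2 hs; linarith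
  rw [div_le_iff₀ hpos, show -(r ^ 2 / 8) = -(s / 2) by rw [hs_def]; ring]
  have h1 : Real.exp (-(s / 2)) * Real.exp s = Real.exp (s / 2) := by
    rw [← Real.exp_add]; ring_nf
  nlinarith [h1, Real.exp_pos (-(s / 2)), Real.exp_pos (s / 2)]

/-- `Φ` is continuous. [folklore] -/
theorem continuous_kerWeight : Continuous kerWeight := by
  unfold kerWeight
  exact (Real.continuous_exp.comp (continuous_pow 2 |>.div_const _).neg).div
    (contDiff_burgersPhi (n := 0) |>.continuous.comp ((continuous_pow 2).div_const _))
    fun r => (burgersPhi_pos _).ne'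

/-! ### Explicit radial integrals -/

/-- `d/dρ [−(c/2) e^{-ρ²/c}] = ρ e^{-ρ²/c}`. [folklore] -/
theorem hasDerivAt_exp_neg_sq_div {c : ℝ} (hc : c ≠ 0) (ρ : ℝ) :
    HasDerivAt (fun ρ : ℝ => -(c / 2) * Real.exp (-(ρ ^ 2 / c))) (ρ * Real.exp (-(ρ ^ 2 / c))) ρ := by
  have h1 : HasDerivAt (fun ρ : ℝ => -(ρ ^ 2 / c)) (-(2 * ρ / c)) ρ := by
    have h := (hasDerivAt_pow 2 ρ).const_mul (-(1 / c))
    refine (h.congr_of_eventuallyEq (Eventually.of_forall fun x => ?_)).congr_deriv ?_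
    · simp only; ring
    · push_cast; ring
  have h2 := ((Real.hasDerivAt_exp _).comp ρ h1).const_mul (-(c / 2))
  refine h2.congr_deriv ?_
  field_simp

/-- **`∫_r^∞ ρ e^{-ρ²/c} dρ = (c/2) e^{-r²/c}`** for `c > 0`, `r ≥ 0`, and the integrand is
integrable on `(r, ∞)`. [folklore] -/
theorem integral_Ioi_mul_exp_neg_sq_div {c : ℝ} (hc : 0 < c) {r : ℝ} (hr : 0 ≤ r) :
    (∫ ρ in Ioi r, ρ * Real.exp (-(ρ ^ 2 / c))) = c / 2 * Real.exp (-(r ^ 2 / c)) ∧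
      IntegrableOn (fun ρ : ℝ => ρ * Real.exp (-(ρ ^ 2 / c))) (Ioi r) := by
  have hderiv : ∀ x ∈ Ici r, HasDerivAt (fun ρ : ℝ => -(c / 2) * Real.exp (-(ρ ^ 2 / c)))
      (x * Real.exp (-(x ^ 2 / c))) x := fun x _ => hasDerivAt_exp_neg_sq_div hc.ne' x
  have hpos : ∀ x ∈ Ioi r, 0 ≤ x * Real.exp (-(x ^ 2 / c)) := fun x hx =>
    mul_nonneg (hr.trans (le_of_lt hx)) (Real.exp_pos _).le
  have hlim : Tendsto (fun ρ : ℝ => -(c / 2) * Real.exp (-(ρ ^ 2 / c))) atTop (𝓝 (-(c / 2) * 0)) := by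
    refine Tendsto.const_mul _ (Real.tendsto_exp_atBot.comp ?_)
    exact tendsto_neg_atTop_atBot.comp ((tendsto_pow_atTop two_ne_zero).atTop_div_const hc)
  rw [mul_zero] at hlim
  refine ⟨?_, integrableOn_Ioi_deriv_of_nonneg' hderiv hpos hlim⟩
  rw [integral_Ioi_of_hasDerivAt_of_nonneg' hderiv hpos hlim]
  ring

/-- **`∫_r^∞ 4ρ⁻³ dρ = 2/r²`** for `r > 0`, and `ρ⁻³` is integrable on `(r, ∞)`. [folklore] -/
theorem integral_Ioi_four_div_cube {r : ℝ} (hr : 0 < r) :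
    (∫ ρ in Ioi r, 4 / ρ ^ 3) = 2 / r ^ 2 ∧ IntegrableOn (fun ρ : ℝ => 4 / ρ ^ 3) (Ioi r) := by
  have hderiv : ∀ x ∈ Ici r, HasDerivAt (fun ρ : ℝ => -2 * (ρ ^ 2)⁻¹) (4 / x ^ 3) x := by
    intro x hx
    have hx0 : x ≠ 0 := (hr.trans_le hx).ne'
    have h := ((hasDerivAt_pow 2 x).inv (pow_ne_zero 2 hx0)).const_mul (-2)
    refine h.congr_deriv ?_
    push_cast
    field_simp
    ring
  have hpos : ∀ x ∈ Ioi r, 0 ≤ 4 / x ^ 3 := fun x hx => by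
    have : 0 < x := hr.trans hx
    positivity
  have hlim : Tendsto (fun ρ : ℝ => -2 * (ρ ^ 2)⁻¹) atTop (𝓝 (-2 * 0)) :=
    (tendsto_inv_atTop_zero.comp (tendsto_pow_atTop two_ne_zero)).const_mul _
  rw [mul_zero] at hlim
  refine ⟨?_, integrableOn_Ioi_deriv_of_nonneg' hderiv hpos hlim⟩
  rw [integral_Ioi_of_hasDerivAt_of_nonneg' hderiv hpos hlim]
  field_simp
  ring

/-! ### The kernel bound `∫ ρ (min/max)² Φ ≤ 7/2` -/

/-- The mode kernel `t(r,ρ) = min(r,ρ)/max(r,ρ) ∈ [0, 1]` for `r > 0`, `ρ ≥ 0`. [folklore] -/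
theorem ratio_mem_Icc {r ρ : ℝ} (hr : 0 < r) (hρ : 0 ≤ ρ) : min r ρ / max r ρ ∈ Icc (0 : ℝ) 1 := by
  have hmax : 0 < max r ρ := lt_of_lt_of_le hr (le_max_left _ _)
  exact ⟨div_nonneg (le_min hr.le hρ) hmax.le, (div_le_one hmax).2 min_le_max⟩

/-- `t(r,ρ)` is continuous in `ρ` (for `r > 0`). [folklore] -/
theorem continuous_ratio {r : ℝ} (hr : 0 < r) : Continuous fun ρ : ℝ => min r ρ / max r ρ :=
  (continuous_const.min continuous_id).div (continuous_const.max continuous_id)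
    fun ρ => (lt_of_lt_of_le hr (le_max_left r ρ)).ne'

/-- `ρ ↦ ρ Φ(ρ)` is integrable on `(0, ∞)` (dominated by `ρ e^{-ρ²/8}`). [folklore] -/
theorem integrableOn_mul_kerWeight : IntegrableOn (fun ρ : ℝ => ρ * kerWeight ρ) (Ioi 0) := by
  refine Integrable.mono' (integral_Ioi_mul_exp_neg_sq_div (c := 8) (by norm_num) le_rfl).2
    ((continuous_id.mul continuous_kerWeight).aestronglyMeasurable) ?_
  refine (ae_restrict_iff' measurableSet_Ioi).2 (Eventually.of_forall fun ρ hρ => ?_)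
  rw [Real.norm_of_nonneg (mul_nonneg (le_of_lt hρ) (kerWeight_pos ρ).le)]
  exact mul_le_mul_of_nonneg_left (kerWeight_le_exp ρ) (le_of_lt hρ)

/-- `ρ ↦ ρ t(r,ρ)^m Φ(ρ)` is integrable on `(0, ∞)`. [folklore] -/
theorem integrableOn_mul_ratio_pow_mul_kerWeight {r : ℝ} (hr : 0 < r) (m : ℕ) :
    IntegrableOn (fun ρ : ℝ => ρ * (min r ρ / max r ρ) ^ m * kerWeight ρ) (Ioi 0) := by
  refine Integrable.mono' integrableOn_mul_kerWeight
    (((continuous_id.mul ((continuous_ratio hr).pow m)).mul continuous_kerWeight).aestronglyMeasurable)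
    ?_
  refine (ae_restrict_iff' measurableSet_Ioi).2 (Eventually.of_forall fun ρ hρ => ?_)
  have ht := ratio_mem_Icc hr (le_of_lt hρ)
  rw [Real.norm_of_nonneg (mul_nonneg (mul_nonneg (le_of_lt hρ) (pow_nonneg ht.1 _))
    (kerWeight_pos ρ).le)]
  calc ρ * (min r ρ / max r ρ) ^ m * kerWeight ρ ≤ ρ * 1 * kerWeight ρ :=
        mul_le_mul_of_nonneg_right (mul_le_mul_of_nonneg_left (pow_le_one₀ ht.1 ht.2) (le_of_lt hρ))
          (kerWeight_pos ρ).le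
    _ = ρ * kerWeight ρ := by ring

/-- The tail integrand `r²Φ(ρ)/ρ` is a.e.-strongly measurable on `(r, ∞)`, `r > 0`. [folklore] -/
theorem aestronglyMeasurable_tail {r : ℝ} (hr : 0 < r) :
    AEStronglyMeasurable (fun ρ : ℝ => r ^ 2 * kerWeight ρ / ρ) (volume.restrict (Ioi r)) := by
  refine ContinuousOn.aestronglyMeasurable ?_ measurableSet_Ioi
  exact (continuous_const.mul continuous_kerWeight).continuousOn.div continuousOn_id
    fun ρ hρ => (hr.trans hρ).ne'

/-- The tail bound `∫_r^∞ r² Φ(ρ)/ρ dρ ≤ 2` (from `Φ(ρ) ≤ 4/ρ²` and `∫_r^∞ 4ρ⁻³ = 2r⁻²`), with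
the integrability of the tail integrand. [folklore] -/
theorem integral_Ioi_tail_le_two {r : ℝ} (hr : 0 < r) :
    (∫ ρ in Ioi r, r ^ 2 * kerWeight ρ / ρ) ≤ 2 ∧
      IntegrableOn (fun ρ : ℝ => r ^ 2 * kerWeight ρ / ρ) (Ioi r) := by
  obtain ⟨hval, hint⟩ := integral_Ioi_four_div_cube hr
  have hle : ∀ ρ ∈ Ioi r, r ^ 2 * kerWeight ρ / ρ ≤ r ^ 2 * (4 / ρ ^ 3) := by
    intro ρ hρ
    have hρ0 : 0 < ρ := hr.trans hρ
    rw [div_le_iff₀ hρ0, show r ^ 2 * (4 / ρ ^ 3) * ρ = r ^ 2 * (4 / ρ ^ 2) by field_simp]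
    exact mul_le_mul_of_nonneg_left (kerWeight_le_div_sq hρ0.ne') (sq_nonneg r)
  have hnn : ∀ ρ ∈ Ioi r, 0 ≤ r ^ 2 * kerWeight ρ / ρ := fun ρ hρ =>
    div_nonneg (mul_nonneg (sq_nonneg r) (kerWeight_pos ρ).le) (hr.trans hρ).le
  have hint' : IntegrableOn (fun ρ : ℝ => r ^ 2 * kerWeight ρ / ρ) (Ioi r) := by
    refine Integrable.mono' (hint.const_mul (r ^ 2)) (aestronglyMeasurable_tail hr) ?_
    refine (ae_restrict_iff' measurableSet_Ioi).2 (Eventually.of_forall fun ρ hρ => ?_)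
    rw [Real.norm_of_nonneg (hnn ρ hρ)]
    exact hle ρ hρ
  refine ⟨?_, hint'⟩
  calc (∫ ρ in Ioi r, r ^ 2 * kerWeight ρ / ρ) ≤ ∫ ρ in Ioi r, r ^ 2 * (4 / ρ ^ 3) :=
        setIntegral_mono_on hint' (hint.const_mul (r ^ 2)) measurableSet_Ioi hle
    _ = 2 := by rw [MeasureTheory.integral_const_mul, hval]; field_simp

/-- The Gaussian tail bound `∫_r^∞ r² Φ(ρ)/ρ dρ ≤ 4e^{-r²/8}` (from `Φ(ρ) ≤ e^{-ρ²/8}` and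
`r²/ρ ≤ ρ` for `ρ ≥ r`). [folklore] -/
theorem integral_Ioi_tail_le_exp {r : ℝ} (hr : 0 < r) :
    (∫ ρ in Ioi r, r ^ 2 * kerWeight ρ / ρ) ≤ 4 * Real.exp (-(r ^ 2 / 8)) := by
  obtain ⟨hval, hint⟩ := integral_Ioi_mul_exp_neg_sq_div (c := 8) (by norm_num) hr.le
  have hle : ∀ ρ ∈ Ioi r, r ^ 2 * kerWeight ρ / ρ ≤ ρ * Real.exp (-(ρ ^ 2 / 8)) := by
    intro ρ hρ
    have hρ0 : 0 < ρ := hr.trans hρ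
    rw [div_le_iff₀ hρ0]
    have h1 : r ^ 2 ≤ ρ * ρ := by nlinarith [le_of_lt (mem_Ioi.1 hρ)]
    calc r ^ 2 * kerWeight ρ ≤ (ρ * ρ) * Real.exp (-(ρ ^ 2 / 8)) :=
          mul_le_mul h1 (kerWeight_le_exp ρ) (kerWeight_pos ρ).le (by positivity)
      _ = ρ * Real.exp (-(ρ ^ 2 / 8)) * ρ := by ring
  calc (∫ ρ in Ioi r, r ^ 2 * kerWeight ρ / ρ) ≤ ∫ ρ in Ioi r, ρ * Real.exp (-(ρ ^ 2 / 8)) :=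
        setIntegral_mono_on (integral_Ioi_tail_le_two hr).2 hint measurableSet_Ioi hle
    _ = 4 * Real.exp (-(r ^ 2 / 8)) := by rw [hval]; ring

/-- The core bound `r⁻² ∫_0^r ρ³Φ ≤ r²/4` (`Φ ≤ 1`), with integrability. [folklore] -/
theorem integral_Ioc_core_le {r : ℝ} (hr : 0 < r) :
    (∫ ρ in Ioc 0 r, ρ ^ 3 * kerWeight ρ / r ^ 2) ≤ r ^ 2 / 4 ∧
      IntegrableOn (fun ρ : ℝ => ρ ^ 3 * kerWeight ρ / r ^ 2) (Ioc 0 r) := by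
  have hc : Continuous fun ρ : ℝ => ρ ^ 3 * kerWeight ρ / r ^ 2 :=
    ((continuous_pow 3).mul continuous_kerWeight).div_const _
  have hint : IntegrableOn (fun ρ : ℝ => ρ ^ 3 * kerWeight ρ / r ^ 2) (Ioc 0 r) :=
    (hc.integrableOn_Icc (a := 0) (b := r)).mono_set Ioc_subset_Icc_self
  have hint3 : IntegrableOn (fun ρ : ℝ => ρ ^ 3 / r ^ 2) (Ioc 0 r) :=
    (((continuous_pow 3).div_const _).integrableOn_Icc (a := 0) (b := r)).mono_set Ioc_subset_Icc_self
  refine ⟨?_, hint⟩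
  calc (∫ ρ in Ioc 0 r, ρ ^ 3 * kerWeight ρ / r ^ 2) ≤ ∫ ρ in Ioc 0 r, ρ ^ 3 / r ^ 2 := by
        refine setIntegral_mono_on hint hint3 measurableSet_Ioc fun ρ hρ => ?_
        have h3 : 0 ≤ ρ ^ 3 := pow_nonneg hρ.1.le 3
        calc ρ ^ 3 * kerWeight ρ / r ^ 2 ≤ ρ ^ 3 * 1 / r ^ 2 := by
              gcongr; exact kerWeight_le_one ρ
          _ = ρ ^ 3 / r ^ 2 := by ring
    _ = r ^ 2 / 4 := by
        rw [← intervalIntegral.integral_of_le hr.le, intervalIntegral.integral_div, integral_pow]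
        field_simp
        ring

/-- The core bound for `r ≥ 2`: `r⁻² ∫_0^r ρ³Φ ≤ 2 − 4/r²` (`Φ ≤ 1` on `[0,2]`, `Φ(ρ) ≤ 4/ρ²` on
`[2, r]`). [folklore] -/
theorem integral_Ioc_core_le' {r : ℝ} (hr : 2 ≤ r) :
    (∫ ρ in Ioc 0 r, ρ ^ 3 * kerWeight ρ / r ^ 2) ≤ 2 - 4 / r ^ 2 := by
  have hr0 : 0 < r := by linarith
  have hc : Continuous fun ρ : ℝ => ρ ^ 3 * kerWeight ρ / r ^ 2 :=
    ((continuous_pow 3).mul continuous_kerWeight).div_const _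
  -- majorant: `ρ³/r²` on `[0,2]`, `4ρ/r²` on `(2, r]`, i.e. `g = min(ρ³, 4ρ)/r²` on `ρ ≥ 0`
  set g : ℝ → ℝ := fun ρ => (if ρ ≤ 2 then ρ ^ 3 else 4 * ρ) / r ^ 2 with hg
  have hle : ∀ ρ ∈ Ioc 0 r, ρ ^ 3 * kerWeight ρ / r ^ 2 ≤ g ρ := by
    intro ρ hρ
    simp only [hg]
    gcongr
    split_ifs with h2
    · calc ρ ^ 3 * kerWeight ρ ≤ ρ ^ 3 * 1 :=
            mul_le_mul_of_nonneg_left (kerWeight_le_one ρ) (pow_nonneg hρ.1.le 3)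
        _ = ρ ^ 3 := mul_one _
    · calc ρ ^ 3 * kerWeight ρ ≤ ρ ^ 3 * (4 / ρ ^ 2) :=
            mul_le_mul_of_nonneg_left (kerWeight_le_div_sq hρ.1.ne') (pow_nonneg hρ.1.le 3)
        _ = 4 * ρ := by
            have : ρ ≠ 0 := hρ.1.ne'
            field_simp
  have hgi1 : IntervalIntegrable (fun ρ : ℝ => ρ ^ 3 / r ^ 2) volume 0 2 :=
    ((continuous_pow 3).div_const _).intervalIntegrable _ _
  have hgi2 : IntervalIntegrable (fun ρ : ℝ => 4 * ρ / r ^ 2) volume 2 r :=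
    ((continuous_const.mul continuous_id).div_const _).intervalIntegrable _ _
  have hg1 : ∀ ρ ∈ Ioc (0 : ℝ) 2, g ρ = ρ ^ 3 / r ^ 2 := fun ρ hρ => by
    simp only [hg, if_pos hρ.2]
  have hg2 : ∀ ρ ∈ Ioc (2 : ℝ) r, g ρ = 4 * ρ / r ^ 2 := fun ρ hρ => by
    simp only [hg, if_neg (not_le.2 hρ.1)]
  have hgi1' : IntervalIntegrable g volume 0 2 := by
    refine hgi1.congr ?_
    rw [uIoc_of_le (by norm_num : (0 : ℝ) ≤ 2)]
    exact fun ρ hρ => (hg1 ρ hρ).symm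
  have hgi2' : IntervalIntegrable g volume 2 r := by
    refine hgi2.congr ?_
    rw [uIoc_of_le hr]
    exact fun ρ hρ => (hg2 ρ hρ).symm
  have hgint : IntegrableOn g (Ioc 0 r) := by
    have := hgi1'.trans hgi2'
    rw [intervalIntegrable_iff_integrableOn_Ioc_of_le hr0.le] at this
    exact this
  have hfint : IntegrableOn (fun ρ : ℝ => ρ ^ 3 * kerWeight ρ / r ^ 2) (Ioc 0 r) :=
    (hc.integrableOn_Icc (a := 0) (b := r)).mono_set Ioc_subset_Icc_self
  calc (∫ ρ in Ioc 0 r, ρ ^ 3 * kerWeight ρ / r ^ 2) ≤ ∫ ρ in Ioc 0 r, g ρ :=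
        setIntegral_mono_on hfint hgint measurableSet_Ioc hle
    _ = (∫ ρ in (0 : ℝ)..2, g ρ) + ∫ ρ in (2 : ℝ)..r, g ρ := by
        rw [← intervalIntegral.integral_of_le hr0.le, intervalIntegral.integral_add_adjacent_intervals hgi1' hgi2']
    _ = (∫ ρ in (0 : ℝ)..2, ρ ^ 3 / r ^ 2) + ∫ ρ in (2 : ℝ)..r, 4 * ρ / r ^ 2 := by
        have hI1 : (∫ ρ in (0 : ℝ)..2, g ρ) = ∫ ρ in (0 : ℝ)..2, ρ ^ 3 / r ^ 2 := by
          refine intervalIntegral.integral_congr fun ρ hρ => ?_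
          rw [uIcc_of_le (by norm_num : (0 : ℝ) ≤ 2)] at hρ
          simp only [hg, if_pos hρ.2]
        have hI2 : (∫ ρ in (2 : ℝ)..r, g ρ) = ∫ ρ in (2 : ℝ)..r, 4 * ρ / r ^ 2 := by
          refine intervalIntegral.integral_congr fun ρ hρ => ?_
          rw [uIcc_of_le hr] at hρ
          rcases hρ.1.eq_or_lt with h | h
          · simp only [hg, ← h]; norm_num
          · simp only [hg, if_neg (not_le.2 h)]
        rw [hI1, hI2]
    _ = 2 - 4 / r ^ 2 := by
        rw [intervalIntegral.integral_div, integral_pow, intervalIntegral.integral_div,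
          intervalIntegral.integral_const_mul, integral_id]
        field_simp
        ring

/-- `e⁻¹ ≤ 3/8` (`e > 8/3`). [folklore] -/
theorem exp_neg_one_le : Real.exp (-1) ≤ 3 / 8 := by
  rw [Real.exp_neg, inv_le_comm₀ (Real.exp_pos _) (by norm_num)]
  have := Real.exp_one_gt_d9
  norm_num at this ⊢
  linarith

/-- **The kernel bound.** For every `r > 0`,
`∫_0^∞ ρ (min(r,ρ)/max(r,ρ))² Φ(ρ) dρ ≤ 7/2` — the quantitative form of Gallay–Wayne's
`sup r²h(r) < 4` that makes the mode-`n` integral operators, `n ≥ 2`, strict contractions in the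
weighted sup norm `sup |f|/Φ`. Cases `r ≤ 2`, `2 < r ≤ 2√2`, `r > 2√2`. [folklore] -/
theorem integral_mul_ratio_sq_mul_kerWeight_le {r : ℝ} (hr : 0 < r) :
    ∫ ρ in Ioi (0 : ℝ), ρ * (min r ρ / max r ρ) ^ 2 * kerWeight ρ ≤ 7 / 2 := by
  have hint := integrableOn_mul_ratio_pow_mul_kerWeight hr 2
  -- split `(0, ∞) = (0, r] ∪ (r, ∞)`
  have hsplit : (∫ ρ in Ioi (0 : ℝ), ρ * (min r ρ / max r ρ) ^ 2 * kerWeight ρ) =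
      (∫ ρ in Ioc 0 r, ρ ^ 3 * kerWeight ρ / r ^ 2) + ∫ ρ in Ioi r, r ^ 2 * kerWeight ρ / ρ := by
    rw [← Ioc_union_Ioi_eq_Ioi hr.le, setIntegral_union (Ioc_disjoint_Ioi le_rfl) measurableSet_Ioi
      (hint.mono_set Ioc_subset_Ioi_self) (hint.mono_set (Ioi_subset_Ioi hr.le))]
    congr 1
    · refine setIntegral_congr_fun measurableSet_Ioc fun ρ hρ => ?_
      rw [min_eq_right hρ.2, max_eq_left hρ.2]
      field_simp
    · refine setIntegral_congr_fun measurableSet_Ioi fun ρ hρ => ?_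
      have hρ0 : 0 < ρ := hr.trans hρ
      rw [min_eq_left (le_of_lt hρ), max_eq_right (le_of_lt hρ)]
      field_simp
  rw [hsplit]
  rcases le_or_gt r 2 with h2 | h2
  · -- `r ≤ 2`: `r²/4 + 2 ≤ 3`
    have h1 := (integral_Ioc_core_le hr).1
    have h3 := (integral_Ioi_tail_le_two hr).1
    nlinarith
  · have h1 := integral_Ioc_core_le' h2.le
    rcases le_or_gt (r ^ 2) 8 with h8 | h8
    · -- `2 < r ≤ 2√2`: `(2 − 4/r²) + 2 ≤ 7/2`
      have h3 := (integral_Ioi_tail_le_two hr).1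
      have h4 : 1 / 2 ≤ 4 / r ^ 2 := by
        rw [div_le_div_iff₀ (by norm_num) (by positivity)]; linarith
      linarith
    · -- `r > 2√2`: `2 + 4e^{-r²/8} ≤ 2 + 4e⁻¹ ≤ 7/2`
      have h3 := integral_Ioi_tail_le_exp hr
      have h4 : Real.exp (-(r ^ 2 / 8)) ≤ Real.exp (-1) := Real.exp_le_exp.2 (by linarith)
      have h5 := exp_neg_one_le
      have h6 : 0 ≤ 4 / r ^ 2 := by positivity
      linarith

/-! ### Modes `n ≥ 2` vanish -/

/-- The integrand `ρ t(r,ρ)^n ‖f(ρ)‖` is integrable on `(0, ∞)` when `ρ‖f(ρ)‖` is. [folklore] -/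
theorem integrableOn_mul_ratio_pow_mul_norm {f : ℝ → ℂ} (hfc : Continuous f)
    (hfi : IntegrableOn (fun ρ : ℝ => ρ * ‖f ρ‖) (Ioi 0)) {r : ℝ} (hr : 0 < r) (n : ℕ) :
    IntegrableOn (fun ρ : ℝ => ρ * (min r ρ / max r ρ) ^ n * ‖f ρ‖) (Ioi 0) := by
  refine Integrable.mono' hfi
    ((continuous_id.mul ((continuous_ratio hr).pow n)).mul hfc.norm).aestronglyMeasurable ?_
  refine (ae_restrict_iff' measurableSet_Ioi).2 (Eventually.of_forall fun ρ hρ => ?_)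
  have ht := ratio_mem_Icc hr (le_of_lt hρ)
  rw [Real.norm_of_nonneg (mul_nonneg (mul_nonneg (le_of_lt hρ) (pow_nonneg ht.1 _)) (norm_nonneg _))]
  calc ρ * (min r ρ / max r ρ) ^ n * ‖f ρ‖ ≤ ρ * 1 * ‖f ρ‖ :=
        mul_le_mul_of_nonneg_right (mul_le_mul_of_nonneg_left (pow_le_one₀ ht.1 ht.2) (le_of_lt hρ))
          (norm_nonneg _)
    _ = ρ * ‖f ρ‖ := by ring

/-- The basic estimate on a solution of the mode-`n` equation:
`‖f(r)‖ ≤ (Φ(r)/(2n)) ∫_0^∞ ρ t^n ‖f(ρ)‖ dρ`. [folklore] -/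
theorem norm_radialMode_le {n : ℕ} {f : ℝ → ℂ} {r : ℝ} (hr : 0 < r)
    (hf : f r = ((kerWeight r / (2 * n) : ℝ) : ℂ) *
      ∫ ρ in Ioi (0 : ℝ), ((ρ * (min r ρ / max r ρ) ^ n : ℝ) : ℂ) * f ρ) :
    ‖f r‖ ≤ kerWeight r / (2 * n) * ∫ ρ in Ioi (0 : ℝ), ρ * (min r ρ / max r ρ) ^ n * ‖f ρ‖ := by
  rw [hf, norm_mul, Complex.norm_real, Real.norm_of_nonneg
    (div_nonneg (kerWeight_pos r).le (by positivity))]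
  refine mul_le_mul_of_nonneg_left ?_ (div_nonneg (kerWeight_pos r).le (by positivity))
  refine (norm_integral_le_integral_norm
    (fun ρ : ℝ => ((ρ * (min r ρ / max r ρ) ^ n : ℝ) : ℂ) * f ρ)).trans (le_of_eq ?_)
  refine setIntegral_congr_fun measurableSet_Ioi fun ρ hρ => ?_
  rw [norm_mul, Complex.norm_real, Real.norm_of_nonneg
    (mul_nonneg (le_of_lt hρ) (pow_nonneg (ratio_mem_Icc hr (le_of_lt hρ)).1 n))]

/-- **The modes `n ≥ 2` of a classical kernel element vanish.** A continuous solution `f` of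
`f(r) = (Φ(r)/(2n)) ∫_0^∞ ρ (min(r,ρ)/max(r,ρ))^n f(ρ) dρ` (`r > 0`) with `∫_0^∞ ρ‖f(ρ)‖dρ < ∞`
and `n ≥ 2` is zero on `(0, ∞)`: from `‖f‖ ≤ M Φ` one gets `‖f‖ ≤ (M/4)Φ(r) ∫ ρ t² Φ ≤ (7/8) M Φ`
(`integral_mul_ratio_sq_mul_kerWeight_le`), starting from `M = ¼∫ρ‖f‖`. [folklore] -/
theorem radialMode_eq_zero {n : ℕ} (hn : 2 ≤ n) {f : ℝ → ℂ} (hfc : Continuous f)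
    (hfi : IntegrableOn (fun ρ : ℝ => ρ * ‖f ρ‖) (Ioi 0))
    (hf : ∀ r, 0 < r → f r = ((kerWeight r / (2 * n) : ℝ) : ℂ) *
      ∫ ρ in Ioi (0 : ℝ), ((ρ * (min r ρ / max r ρ) ^ n : ℝ) : ℂ) * f ρ) :
    ∀ r, 0 < r → f r = 0 := by
  have hn4 : (4 : ℝ) ≤ 2 * n := by
    have : (2 : ℝ) ≤ n := by exact_mod_cast hn
    linarith
  have hquarter : ∀ r : ℝ, kerWeight r / (2 * n) ≤ kerWeight r / 4 := fun r =>
    div_le_div_of_nonneg_left (kerWeight_pos r).le (by norm_num) hn4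
  have hint := fun r (hr : 0 < r) => integrableOn_mul_ratio_pow_mul_norm hfc hfi hr n
  -- the improving step
  have hstep : ∀ C : ℝ, 0 ≤ C → (∀ ρ, 0 < ρ → ‖f ρ‖ ≤ C * kerWeight ρ) →
      ∀ r, 0 < r → ‖f r‖ ≤ (7 / 8 * C) * kerWeight r := by
    intro C hC hCf r hr
    have h2 : (∫ ρ in Ioi (0 : ℝ), ρ * (min r ρ / max r ρ) ^ n * ‖f ρ‖) ≤
        ∫ ρ in Ioi (0 : ℝ), C * (ρ * (min r ρ / max r ρ) ^ 2 * kerWeight ρ) := by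
      refine setIntegral_mono_on (hint r hr)
        ((integrableOn_mul_ratio_pow_mul_kerWeight hr 2).const_mul C) measurableSet_Ioi
        fun ρ hρ => ?_
      have ht := ratio_mem_Icc hr (le_of_lt hρ)
      calc ρ * (min r ρ / max r ρ) ^ n * ‖f ρ‖
          ≤ ρ * (min r ρ / max r ρ) ^ 2 * (C * kerWeight ρ) :=
            mul_le_mul (mul_le_mul_of_nonneg_left (pow_le_pow_of_le_one ht.1 ht.2 hn) (le_of_lt hρ))
              (hCf ρ hρ) (norm_nonneg _) (mul_nonneg (le_of_lt hρ) (pow_nonneg ht.1 2))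
        _ = C * (ρ * (min r ρ / max r ρ) ^ 2 * kerWeight ρ) := by ring
    have h3 : (∫ ρ in Ioi (0 : ℝ), C * (ρ * (min r ρ / max r ρ) ^ 2 * kerWeight ρ)) ≤ C * (7 / 2) := by
      rw [MeasureTheory.integral_const_mul]
      exact mul_le_mul_of_nonneg_left (integral_mul_ratio_sq_mul_kerWeight_le hr) hC
    calc ‖f r‖ ≤ kerWeight r / (2 * n) * ∫ ρ in Ioi (0 : ℝ), ρ * (min r ρ / max r ρ) ^ n * ‖f ρ‖ :=
          norm_radialMode_le hr (hf r hr)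
      _ ≤ kerWeight r / 4 * (C * (7 / 2)) :=
          mul_le_mul (hquarter r) (h2.trans h3)
            (setIntegral_nonneg measurableSet_Ioi fun ρ hρ => mul_nonneg (mul_nonneg (le_of_lt hρ)
              (pow_nonneg (ratio_mem_Icc hr (le_of_lt hρ)).1 n)) (norm_nonneg _))
            (div_nonneg (kerWeight_pos r).le (by norm_num))
      _ = (7 / 8 * C) * kerWeight r := by ring
  -- the starting bound
  set M₀ : ℝ := (1 / 4) * ∫ ρ in Ioi (0 : ℝ), ρ * ‖f ρ‖ with hM₀
  have hM₀nn : 0 ≤ M₀ := by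
    rw [hM₀]
    exact mul_nonneg (by norm_num) (setIntegral_nonneg measurableSet_Ioi fun ρ hρ =>
      mul_nonneg (le_of_lt hρ) (norm_nonneg _))
  have hbase : ∀ r, 0 < r → ‖f r‖ ≤ M₀ * kerWeight r := by
    intro r hr
    have h2 : (∫ ρ in Ioi (0 : ℝ), ρ * (min r ρ / max r ρ) ^ n * ‖f ρ‖) ≤ ∫ ρ in Ioi (0 : ℝ), ρ * ‖f ρ‖ := by
      refine setIntegral_mono_on (hint r hr) hfi measurableSet_Ioi fun ρ hρ => ?_
      have ht := ratio_mem_Icc hr (le_of_lt hρ)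
      calc ρ * (min r ρ / max r ρ) ^ n * ‖f ρ‖ ≤ ρ * 1 * ‖f ρ‖ :=
            mul_le_mul_of_nonneg_right (mul_le_mul_of_nonneg_left (pow_le_one₀ ht.1 ht.2) (le_of_lt hρ))
              (norm_nonneg _)
        _ = ρ * ‖f ρ‖ := by ring
    calc ‖f r‖ ≤ kerWeight r / (2 * n) * ∫ ρ in Ioi (0 : ℝ), ρ * (min r ρ / max r ρ) ^ n * ‖f ρ‖ :=
          norm_radialMode_le hr (hf r hr)
      _ ≤ kerWeight r / 4 * ∫ ρ in Ioi (0 : ℝ), ρ * ‖f ρ‖ :=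
          mul_le_mul (hquarter r) h2
            (setIntegral_nonneg measurableSet_Ioi fun ρ hρ => mul_nonneg (mul_nonneg (le_of_lt hρ)
              (pow_nonneg (ratio_mem_Icc hr (le_of_lt hρ)).1 n)) (norm_nonneg _))
            (div_nonneg (kerWeight_pos r).le (by norm_num))
      _ = M₀ * kerWeight r := by rw [hM₀]; ring
  -- iterate
  have hiter : ∀ k : ℕ, ∀ r, 0 < r → ‖f r‖ ≤ ((7 / 8 : ℝ) ^ k * M₀) * kerWeight r := by
    intro k
    induction k with
    | zero => simpa using hbase
    | succ k ih =>
        intro r hr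
        have h := hstep ((7 / 8 : ℝ) ^ k * M₀) (by positivity) ih r hr
        calc ‖f r‖ ≤ (7 / 8 * ((7 / 8 : ℝ) ^ k * M₀)) * kerWeight r := h
          _ = ((7 / 8 : ℝ) ^ (k + 1) * M₀) * kerWeight r := by ring
  intro r hr
  have hlim : Tendsto (fun k : ℕ => ((7 / 8 : ℝ) ^ k * M₀) * kerWeight r) atTop
      (𝓝 ((0 * M₀) * kerWeight r)) :=
    ((tendsto_pow_atTop_nhds_zero_of_lt_one (by norm_num) (by norm_num)).mul_const M₀).mul_const _
  rw [zero_mul, zero_mul] at hlim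
  have h0 : ‖f r‖ ≤ 0 := ge_of_tendsto hlim (Eventually.of_forall fun k => hiter k r hr)
  exact norm_le_zero_iff.1 h0

/-! ### Mode `n = 1` is spanned by `r e^{-r²/4}` -/

/-- A continuous `f` with `∫_0^∞ ρ‖f(ρ)‖ dρ < ∞` is integrable on `(0, ∞)`. [folklore] -/
theorem integrableOn_Ioi_of_mul_norm {f : ℝ → ℂ} (hfc : Continuous f)
    (hfi : IntegrableOn (fun ρ : ℝ => ρ * ‖f ρ‖) (Ioi 0)) : IntegrableOn f (Ioi 0) := by
  rw [← Ioc_union_Ioi_eq_Ioi zero_le_one]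
  refine IntegrableOn.union ((hfc.integrableOn_Icc (a := 0) (b := 1)).mono_set Ioc_subset_Icc_self) ?_
  refine Integrable.mono' (hfi.mono_set (Ioi_subset_Ioi zero_le_one)) hfc.aestronglyMeasurable ?_
  refine (ae_restrict_iff' measurableSet_Ioi).2 (Eventually.of_forall fun ρ hρ => ?_)
  calc ‖f ρ‖ = 1 * ‖f ρ‖ := (one_mul _).symm
    _ ≤ ρ * ‖f ρ‖ := mul_le_mul_of_nonneg_right (le_of_lt hρ) (norm_nonneg _)

/-- The mode integrand `ρ t(r,ρ)^n f(ρ)` is integrable on `(0, ∞)`. [folklore] -/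
theorem integrableOn_ratio_pow_mul {f : ℝ → ℂ} (hfc : Continuous f)
    (hfi : IntegrableOn (fun ρ : ℝ => ρ * ‖f ρ‖) (Ioi 0)) {r : ℝ} (hr : 0 < r) (n : ℕ) :
    IntegrableOn (fun ρ : ℝ => ((ρ * (min r ρ / max r ρ) ^ n : ℝ) : ℂ) * f ρ) (Ioi 0) := by
  refine Integrable.mono' (integrableOn_mul_ratio_pow_mul_norm hfc hfi hr n)
    ((Complex.continuous_ofReal.comp (continuous_id.mul ((continuous_ratio hr).pow n))).mul
      hfc).aestronglyMeasurable ?_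
  refine (ae_restrict_iff' measurableSet_Ioi).2 (Eventually.of_forall fun ρ hρ => ?_)
  rw [norm_mul, Complex.norm_real, Real.norm_of_nonneg
    (mul_nonneg (le_of_lt hρ) (pow_nonneg (ratio_mem_Icc hr (le_of_lt hρ)).1 n))]

/-- **Splitting the mode-`1` integral at `ρ = r`**:
`∫_0^∞ ρ t(r,ρ) f(ρ) dρ = r⁻¹ ∫_0^r ρ² f + r ∫_r^∞ f`, with `∫_r^∞ f = ∫_0^∞ f − ∫_0^r f`. [folklore] -/
theorem integral_ratio_mul_eq_split {f : ℝ → ℂ} (hfc : Continuous f)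
    (hfi : IntegrableOn (fun ρ : ℝ => ρ * ‖f ρ‖) (Ioi 0)) {r : ℝ} (hr : 0 < r) :
    (∫ ρ in Ioi (0 : ℝ), ((ρ * (min r ρ / max r ρ) ^ 1 : ℝ) : ℂ) * f ρ) =
      (r : ℂ)⁻¹ * (∫ ρ in (0 : ℝ)..r, ((ρ ^ 2 : ℝ) : ℂ) * f ρ) +
        (r : ℂ) * ((∫ ρ in Ioi (0 : ℝ), f ρ) - ∫ ρ in (0 : ℝ)..r, f ρ) := by
  have hint := integrableOn_ratio_pow_mul hfc hfi hr 1
  have hfI := integrableOn_Ioi_of_mul_norm hfc hfi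
  have hsplitf : (∫ ρ in Ioi (0 : ℝ), f ρ) = (∫ ρ in (0 : ℝ)..r, f ρ) + ∫ ρ in Ioi r, f ρ := by
    rw [← Ioc_union_Ioi_eq_Ioi hr.le, setIntegral_union (Ioc_disjoint_Ioi le_rfl) measurableSet_Ioi
      (hfI.mono_set Ioc_subset_Ioi_self) (hfI.mono_set (Ioi_subset_Ioi hr.le)),
      intervalIntegral.integral_of_le hr.le]
  rw [hsplitf, add_sub_cancel_left, ← Ioc_union_Ioi_eq_Ioi hr.le,
    setIntegral_union (Ioc_disjoint_Ioi le_rfl) measurableSet_Ioi (hint.mono_set Ioc_subset_Ioi_self)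
      (hint.mono_set (Ioi_subset_Ioi hr.le))]
  congr 1
  · rw [intervalIntegral.integral_of_le hr.le, ← MeasureTheory.integral_const_mul]
    refine setIntegral_congr_fun measurableSet_Ioc fun ρ hρ => ?_
    rw [min_eq_right hρ.2, max_eq_left hρ.2]
    have : (r : ℂ) ≠ 0 := by exact_mod_cast hr.ne'
    push_cast
    field_simp
  · rw [← MeasureTheory.integral_const_mul]
    refine setIntegral_congr_fun measurableSet_Ioi fun ρ hρ => ?_
    have hρ0 : ρ ≠ 0 := (hr.trans hρ).ne'
    rw [min_eq_left (le_of_lt hρ), max_eq_right (le_of_lt hρ), pow_one, mul_div_cancel₀ _ hρ0]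

/-- **The mode `n = 1` of a classical kernel element is a multiple of `r e^{-r²/4}`** (the first
angular mode of `x₁G`, up to normalisation). For a continuous `f` with `∫_0^∞ρ‖f‖ < ∞` solving
`f(r) = (Φ(r)/2) ∫_0^∞ ρ (min(r,ρ)/max(r,ρ)) f(ρ) dρ` for `r > 0`, there is `c ∈ ℂ` with
`f(r) = c r e^{-r²/4}` on `(0, ∞)`. Proof: with `A_f = ∫_0^r ρ²f`, `B_f = ∫_r^∞ f` the equation
reads `2rf = Φ(A_f + r²B_f)`; the same holds for `h = re^{-r²/4}` with `A_h = 8 − 2(r²+4)e^{-r²/4}`,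
`B_h = 2e^{-r²/4}`; the Wronskian `A_fB_h − A_hB_f` has zero derivative and vanishes at `0`, whence
`fB_h = hB_f`, so `B_f/B_h` has zero derivative on `(0,∞)`, `B_f = cB_h` and `f = ch`. [folklore] -/
theorem radialMode_one_eq_smul {f : ℝ → ℂ} (hfc : Continuous f)
    (hfi : IntegrableOn (fun ρ : ℝ => ρ * ‖f ρ‖) (Ioi 0))
    (hf : ∀ r, 0 < r → f r = ((kerWeight r / (2 * (1 : ℕ)) : ℝ) : ℂ) *
      ∫ ρ in Ioi (0 : ℝ), ((ρ * (min r ρ / max r ρ) ^ 1 : ℝ) : ℂ) * f ρ) :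
    ∃ c : ℂ, ∀ r, 0 < r → f r = c * ((r * Real.exp (-(r ^ 2 / 4)) : ℝ) : ℂ) := by
  -- the four primitives
  set Af : ℝ → ℂ := fun r => ∫ ρ in (0 : ℝ)..r, ((ρ ^ 2 : ℝ) : ℂ) * f ρ with hAf
  set Bf : ℝ → ℂ := fun r => (∫ ρ in Ioi (0 : ℝ), f ρ) - ∫ ρ in (0 : ℝ)..r, f ρ with hBf
  set h : ℝ → ℝ := fun r => r * Real.exp (-(r ^ 2 / 4)) with hh
  set Ah : ℝ → ℝ := fun r => 8 - 2 * (r ^ 2 + 4) * Real.exp (-(r ^ 2 / 4)) with hAh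
  set Bh : ℝ → ℝ := fun r => 2 * Real.exp (-(r ^ 2 / 4)) with hBh
  -- the equations `2 r f = Φ (A_f + r² B_f)`, `2 r h = Φ (A_h + r² B_h)` on `(0, ∞)`
  have heqf : ∀ r : ℝ, 0 < r → 2 * (r : ℂ) * f r = (kerWeight r : ℂ) * (Af r + (r : ℂ) ^ 2 * Bf r) := by
    intro r hr
    rw [hf r hr, integral_ratio_mul_eq_split hfc hfi hr]
    simp only [hAf, hBf]
    have : (r : ℂ) ≠ 0 := by exact_mod_cast hr.ne'
    push_cast
    field_simp
  have heqh : ∀ r : ℝ, 0 < r → 2 * r * h r = kerWeight r * (Ah r + r ^ 2 * Bh r) := by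
    intro r hr
    simp only [hh, hAh, hBh]
    rw [kerWeight_eq hr.ne']
    have hE : Real.exp (r ^ 2 / 4) - 1 ≠ 0 := by
      have : 1 < Real.exp (r ^ 2 / 4) := Real.one_lt_exp_iff.2 (by positivity); linarith
    have hE' : Real.exp (-(r ^ 2 / 4)) * Real.exp (r ^ 2 / 4) = 1 := by
      rw [← Real.exp_add]; simp
    field_simp
    linear_combination 8 * hE'
  -- derivatives
  have hcA : Continuous fun ρ : ℝ => ((ρ ^ 2 : ℝ) : ℂ) * f ρ :=
    (Complex.continuous_ofReal.comp (continuous_pow 2)).mul hfc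
  have hAf' : ∀ r, HasDerivAt Af (((r ^ 2 : ℝ) : ℂ) * f r) r := fun r =>
    intervalIntegral.integral_hasDerivAt_right (hcA.intervalIntegrable _ _)
      (hcA.stronglyMeasurableAtFilter _ _) hcA.continuousAt
  have hBf' : ∀ r, HasDerivAt Bf (-f r) r := fun r => by
    simpa using (intervalIntegral.integral_hasDerivAt_right (hfc.intervalIntegrable 0 r)
      (hfc.stronglyMeasurableAtFilter _ _) hfc.continuousAt).const_sub (∫ ρ in Ioi (0 : ℝ), f ρ)
  have hexp' : ∀ r, HasDerivAt (fun ρ : ℝ => Real.exp (-(ρ ^ 2 / 4))) (-(r / 2) * Real.exp (-(r ^ 2 / 4))) r := by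
    intro r
    have h1 : HasDerivAt (fun ρ : ℝ => -(ρ ^ 2 / 4)) (-(r / 2)) r := by
      have h := (hasDerivAt_pow 2 r).const_mul (-(1 / 4 : ℝ))
      refine (h.congr_of_eventuallyEq (Eventually.of_forall fun y => ?_)).congr_deriv ?_
      · simp only; ring
      · push_cast; ring
    exact ((Real.hasDerivAt_exp _).comp r h1).congr_deriv (by ring)
  have hAh' : ∀ r, HasDerivAt Ah (r ^ 2 * h r) r := by
    intro r
    have h1 : HasDerivAt (fun ρ : ℝ => 2 * (ρ ^ 2 + 4)) (2 * (2 * r)) r := by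
      refine (((hasDerivAt_pow 2 r).add_const 4).const_mul 2).congr_deriv ?_
      push_cast; ring
    refine ((h1.mul (hexp' r)).const_sub 8).congr_deriv ?_
    simp only [hh]; ring
  have hBh' : ∀ r, HasDerivAt Bh (-h r) r := fun r =>
    ((hexp' r).const_mul 2).congr_deriv (by simp only [hh]; ring)
  -- the Wronskian `D = A_f B_h − A_h B_f` is constant `= 0` on `[0, ∞)`
  set D : ℝ → ℂ := fun r => Af r * (Bh r : ℂ) - (Ah r : ℂ) * Bf r with hD
  have hD' : ∀ r : ℝ, HasDerivAt D (f r * (((r ^ 2 * Bh r + Ah r) : ℝ) : ℂ) -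
      (h r : ℂ) * (Af r + (r : ℂ) ^ 2 * Bf r)) r := by
    intro r
    have h1 := (hAf' r).mul ((hBh' r).ofReal_comp)
    have h2 := ((hAh' r).ofReal_comp).mul (hBf' r)
    refine (h1.sub h2).congr_deriv ?_
    push_cast
    ring
  have hD'zero : ∀ r : ℝ, 0 ≤ r → f r * (((r ^ 2 * Bh r + Ah r) : ℝ) : ℂ) -
      (h r : ℂ) * (Af r + (r : ℂ) ^ 2 * Bf r) = 0 := by
    intro r hr
    rcases hr.eq_or_lt with h0 | hpos
    · subst h0
      simp only [hh, hAh]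
      norm_num
    · have hk : (kerWeight r : ℂ) ≠ 0 := by exact_mod_cast (kerWeight_pos r).ne'
      have hk' : kerWeight r ≠ 0 := (kerWeight_pos r).ne'
      have e1 := heqf r hpos
      have e2 := heqh r hpos
      have e2r : r ^ 2 * Bh r + Ah r = (kerWeight r)⁻¹ * (2 * r * h r) := by
        rw [e2]
        field_simp
        all_goals ring
      have e2' : ((r ^ 2 * Bh r + Ah r : ℝ) : ℂ) = (kerWeight r : ℂ)⁻¹ * (2 * r * h r) := by
        rw [e2r]; push_cast; ring
      have e1' : Af r + (r : ℂ) ^ 2 * Bf r = (kerWeight r : ℂ)⁻¹ * (2 * (r : ℂ) * f r) := by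
        rw [e1, ← mul_assoc, inv_mul_cancel₀ hk, one_mul]
      rw [e2', e1']
      ring
  have hDconst : ∀ r, 0 ≤ r → D r = D 0 := by
    intro r hr
    have h := Convex.norm_image_sub_le_of_norm_hasDerivWithin_le (f := D) (s := Ici (0 : ℝ)) (C := 0)
      (fun x hx => (hD' x).hasDerivWithinAt) (fun x hx => by rw [hD'zero x hx, norm_zero])
      (convex_Ici 0) (mem_Ici.2 le_rfl) (mem_Ici.2 hr)
    rw [zero_mul, norm_le_zero_iff, sub_eq_zero] at h
    exact h
  have hD0 : D 0 = 0 := by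
    simp only [hD, hAf, hAh, intervalIntegral.integral_same, zero_mul, zero_sub]
    norm_num
  -- hence `f B_h = h B_f` on `(0, ∞)`
  have hkey : ∀ r : ℝ, 0 < r → f r * (Bh r : ℂ) = (h r : ℂ) * Bf r := by
    intro r hr
    have hDr : Af r * (Bh r : ℂ) = (Ah r : ℂ) * Bf r := by
      have := hDconst r hr.le
      rw [hD0] at this
      exact sub_eq_zero.1 this
    have e1 := heqf r hr
    have e2 := heqh r hr
    have h2r : (2 * (r : ℂ)) ≠ 0 := by exact_mod_cast (by positivity : (2 * r : ℝ) ≠ 0)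
    apply mul_left_cancel₀ h2r
    calc 2 * (r : ℂ) * (f r * (Bh r : ℂ)) = (kerWeight r : ℂ) * (Af r + (r : ℂ) ^ 2 * Bf r) * (Bh r : ℂ) := by
          rw [← e1]; ring
      _ = (kerWeight r : ℂ) * (Af r * (Bh r : ℂ) + (r : ℂ) ^ 2 * Bf r * (Bh r : ℂ)) := by ring
      _ = (kerWeight r : ℂ) * ((Ah r : ℂ) * Bf r + (r : ℂ) ^ 2 * Bf r * (Bh r : ℂ)) := by rw [hDr]
      _ = ((kerWeight r * (Ah r + r ^ 2 * Bh r) : ℝ) : ℂ) * Bf r := by push_cast; ring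
      _ = 2 * (r : ℂ) * ((h r : ℂ) * Bf r) := by rw [← e2]; push_cast; ring
  -- `B_h > 0`, and `B_f / B_h` has zero derivative on `(0, ∞)`
  have hBhpos : ∀ r, 0 < Bh r := fun r => by simp only [hBh]; positivity
  set q : ℝ → ℂ := fun r => Bf r / (Bh r : ℂ) with hq
  have hq' : ∀ r, 0 < r → HasDerivAt q 0 r := by
    intro r hr
    have hB0 : (Bh r : ℂ) ≠ 0 := by exact_mod_cast (hBhpos r).ne'
    have h1 := (hBf' r).div ((hBh' r).ofReal_comp) hB0
    refine h1.congr_deriv ?_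
    rw [div_eq_zero_iff]
    left
    have := hkey r hr
    rw [Complex.ofReal_neg]
    linear_combination -this
  have hqconst : ∀ r, 0 < r → q r = q 1 := by
    intro r hr
    have h := Convex.norm_image_sub_le_of_norm_hasDerivWithin_le (f := q) (s := Ioi (0 : ℝ)) (C := 0)
      (f' := fun _ => 0) (fun x hx => (hq' x hx).hasDerivWithinAt) (fun x _ => by rw [norm_zero])
      (convex_Ioi 0) (mem_Ioi.2 zero_lt_one) (mem_Ioi.2 hr)
    rw [zero_mul, norm_le_zero_iff, sub_eq_zero] at h
    exact h
  refine ⟨q 1, fun r hr => ?_⟩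
  have hB0 : (Bh r : ℂ) ≠ 0 := by exact_mod_cast (hBhpos r).ne'
  have hBf : Bf r = q 1 * (Bh r : ℂ) := by
    rw [← hqconst r hr, hq]
    field_simp
  have := hkey r hr
  rw [hBf] at this
  apply mul_right_cancel₀ hB0
  calc f r * (Bh r : ℂ) = (h r : ℂ) * (q 1 * (Bh r : ℂ)) := this
    _ = q 1 * ((r * Real.exp (-(r ^ 2 / 4)) : ℝ) : ℂ) * (Bh r : ℂ) := by
        simp only [hh]; push_cast; ring

end Literature.Analysis.FluidPDE
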